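import Mathlib
import Summits.NavierStokesRegularity.NavierStokesRegularity.Theses.QuarterTurnRdss
import Summits.NavierStokesRegularity.NavierStokesRegularity.Theorems.FilamentSkeletonRssRdssProfileTruncation
import HarnessLib

/-!
# `QuarterTurnRdss.DssProfileTruncation` — the plain-DSS truncation bridge
  (item stmt-NavierStokesRegularity-2459)

**Statement.** If some factor `c > 1` admits a NONTRIVIAL ancient mild solution (`ν = 1`,
measurable slices) on `ℝ³ × (−∞,0)` which is `c`-discretely self-similar and Type-I bounded
(`|u| ≤ C₀/(|x|+√−t)`), then for some `ν > 0`, `T > 0` there is a Leray–Hopf classical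
Navier–Stokes solution from a rapidly decaying datum with finite maximal lifespan `T`
(`IsMaximalSmoothSolution ∧ IsLerayHopfOn ∧ HasRapidSpatialDecay (u 0)`).

PROOF. Plain `c`-DSS is rotated `c`-DSS with the trivial isometry
(`Literature.Analysis.FluidPDE.isRotatedDSS_refl_iff`), so the hypothesis is the `R = 1` instance
of the hypothesis of the ACCEPTED sibling theorem `filamentSkeletonRss_rdssProfileTruncation_proof`
(`Theses.FilamentSkeletonRss.RdssProfileTruncation`, stmt-NavierStokesRegularity-11289), whose
conclusion is verbatim the conclusion of this item.

HONEST FRAMING: a bookkeeping corollary of an accepted tree theorem about HYPOTHETICAL objects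
(nontrivial Type-I DSS ancient profiles, whose existence is open — Bradshaw–Tsai Open Problem 5.1);
nothing here bears on the regularity problem itself.
-/

noncomputable section

set_option linter.dupNamespace false

namespace Summit.NavierStokesRegularity.NavierStokesRegularity.Theorems

open MeasureTheory Literature.Analysis.FluidPDE

/-- **Item stmt-NavierStokesRegularity-2459** (`QuarterTurnRdss.DssProfileTruncation`): a
nontrivial Type-I plain-DSS ancient mild profile yields a Leray–Hopf classical solution from a
rapidly decaying datum with finite maximal lifespan — the `R = 1` case
(`isRotatedDSS_refl_iff`) of the accepted `filamentSkeletonRss_rdssProfileTruncation_proof`.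
[cite: BradshawTsai2017CPDE, §5 Open Problem 5.1] -/
theorem dssProfileTruncation_proof :
    Summit.NavierStokesRegularity.NavierStokesRegularity.Theses.QuarterTurnRdss.DssProfileTruncation := by
  unfold Summit.NavierStokesRegularity.NavierStokesRegularity.Theses.QuarterTurnRdss.DssProfileTruncation
  rintro ⟨c, hc, u, hu, hmeas, hdss, hdec, hnz⟩
  exact filamentSkeletonRss_rdssProfileTruncation_proof
    ⟨c, LinearIsometryEquiv.refl ℝ (EuclideanSpace ℝ (Fin 3)), u, hc, hu, hmeas,
      isRotatedDSS_refl_iff.2 hdss, hdec, hnz⟩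

end Summit.NavierStokesRegularity.NavierStokesRegularity.Theorems

end
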